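import Mathlib.LinearAlgebra.FiniteDimensional.Lemmas
import Mathlib.LinearAlgebra.Dimension.Constructions
import Mathlib.LinearAlgebra.Basis.Prod
import Mathlib.LinearAlgebra.StdBasis
import Literature.InformationTheory.QuantumCodes.SymplecticCodes
import HarnessLib

/-!
# The quantum Singleton bound for stabilizer codes: `k + 2(d − 1) ≤ n`

Rains, *Nonbinary quantum codes*, IEEE Trans. Inform. Theory 45 (1999) 1827–1832
[Rains1999Nonbinary], Theorem 2 (Quantum Singleton bound): "Let `C` be a `((n,K,d))_α` with
`K > 1`. Then `K ≤ α^{n−2d+2}`." (Knill–Laflamme 1997 for `α = 2`; Calderbank–Rains–Shor–Sloane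
1998 eq. (15) quote it as `n ≥ 4e + k`, and prove the pure additive case, their Theorem 23, which
the tree has as `CRSS1998_theorem23`.) This file PROVES the bound for all (pure or impure) binary
ADDITIVE (= stabilizer) codes in the tree's symplectic vocabulary (`SymplecticCodes.lean`):

  `quantumSingleton_additive : IsAdditiveCode S k d → 1 ≤ k → k + 2 * d ≤ n + 2`,
  `AdditiveCodeExists.quantumSingleton : AdditiveCodeExists n k d → 1 ≤ k → k + 2 * d ≤ n + 2`.

TODO(general form): non-additive `((n,K,d))` codes and alphabets `α > 2` (Rains's enumerator proof).

## Proof (the "cleaning" dimension count, not Rains's weight-enumerator argument)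

For a coordinate set `M` write `P(M)` for the symplectic vectors supported on `M`
(`supportedOn M`, `dim ≤ 2|M|`), `T(M) = T ∩ P(M)`, and `ρ_M` for the projection onto `P(M)`.
For a subspace `S̄ ≤ 𝔽₂^{2n}`:
(1) `dim S̄ = dim ρ_M(S̄) + dim S̄(Mᶜ)` (rank–nullity);
(2) `ρ_M(S̄)⊥ ≤ P(Mᶜ) + S̄⊥(M)` (a vector orthogonal to the `M`-parts of `S̄` has its own `M`-part
    orthogonal to `S̄`), so with `dim T⊥ + dim T = 2n` (`finrank_sympDual_add`):
    `dim S̄⊥(M) + dim S̄ ≥ 2|M| + dim S̄(Mᶜ)` — the dimension form of the Cleaning Lemma;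
(3) `dim T(A ∪ B) ≤ dim T(A) + 2|B|` (project onto `B`);
(4) if `|M| ≤ d − 1` then `S̄⊥(M) = S̄(M)` (minimum distance + `S̄ ≤ S̄⊥`).
With `|M₁| = |M₂| = d − 1` disjoint and `M₃` the rest (`|M₃| = n − 2(d−1)`): (2) for `M₁ᶜ = M₂ ∪ M₃`,
(3), (4) give `k ≤ n − 2d + 2 + dim S̄(M₂) − dim S̄(M₁)`; symmetrising in `M₁, M₂` yields the
bound. The boundary cases (`n < 2(d−1)`, where (2)+(4) force `k = 0`) are where `1 ≤ k` is used.

## References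

* E. M. Rains, IEEE TIT 45 (1999) 1827, Thm 2 [Rains1999Nonbinary]; E. Knill, R. Laflamme,
  Phys. Rev. A 55 (1997) 900; CRSS 1998 §7 eq. (15) [CalderbankEtAl1998].
* The cleaning count: S. Bravyi, B. Terhal, New J. Phys. 11 (2009) 043029, Lemma 1 (Cleaning
  Lemma) [BravyiTerhal2009] — the dichotomy behind (2)/(4).

## Mathlib / tree search

Tree: `SympVec`, `sympInner`, `sympDual`, `IsSelfOrthogonal`, `HasMinDist`, `IsAdditiveCode`,
`AdditiveCodeExists`, `finrank_sympDual_add`, `IsAdditiveCode.finrank_sympDual`, `sympWeight`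
(SymplecticCodes.lean); `CRSS1998_theorem23(_holds)` is the PURE case only. No general quantum
Singleton bound in tree or Mathlib (`lean search 'Singleton'`: classical `maxCodeSize_le_two_pow_sub`
only).
-/

namespace Literature.InformationTheory.QuantumCodes

open Matrix Finset Module

variable {n : ℕ}

/-! ### Vectors supported on a coordinate set and the projection onto them -/

/-- `P(M)`: the symplectic vectors `(a|b)` supported on `M` (`aᵢ = bᵢ = 0` off `M`), i.e. the Pauli
operators acting only on the qubits of `M`. [cite: BravyiTerhal2009, §2 (𝒫(M), operators supported in M)] -/
def supportedOn (M : Finset (Fin n)) : Submodule (ZMod 2) (SympVec n) where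
  carrier := {v | ∀ i, i ∉ M → v.1 i = 0 ∧ v.2 i = 0}
  zero_mem' := by intro i _; simp
  add_mem' {v w} hv hw := by
    intro i hi
    simp [(hv i hi).1, (hv i hi).2, (hw i hi).1, (hw i hi).2]
  smul_mem' c {v} hv := by
    intro i hi
    simp [(hv i hi).1, (hv i hi).2]

/-- Membership in `P(M)`. [cite: BravyiTerhal2009, §2] -/
theorem mem_supportedOn_iff {M : Finset (Fin n)} {v : SympVec n} :
    v ∈ supportedOn M ↔ ∀ i, i ∉ M → v.1 i = 0 ∧ v.2 i = 0 :=
  Iff.rfl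

/-- `ρ_M`: restriction of `(a|b)` to `M` (zero off `M`), as a linear map — the "restriction of `P`
onto `M`" of the Cleaning Lemma. [cite: BravyiTerhal2009, §2 (P_M, restriction onto M)] -/
def proj (M : Finset (Fin n)) : SympVec n →ₗ[ZMod 2] SympVec n where
  toFun v := (fun i => if i ∈ M then v.1 i else 0, fun i => if i ∈ M then v.2 i else 0)
  map_add' v w := by
    ext i <;> by_cases hi : i ∈ M <;> simp [hi]
  map_smul' c v := by
    ext i <;> by_cases hi : i ∈ M <;> simp [hi]

/-- First component of `ρ_M v`. [cite: BravyiTerhal2009, §2] -/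
@[simp] theorem proj_apply_fst (M : Finset (Fin n)) (v : SympVec n) (i : Fin n) :
    (proj M v).1 i = if i ∈ M then v.1 i else 0 := rfl

/-- Second component of `ρ_M v`. [cite: BravyiTerhal2009, §2] -/
@[simp] theorem proj_apply_snd (M : Finset (Fin n)) (v : SympVec n) (i : Fin n) :
    (proj M v).2 i = if i ∈ M then v.2 i else 0 := rfl

/-- `ρ_M v ∈ P(M)`. [cite: BravyiTerhal2009, §2] -/
theorem proj_mem_supportedOn (M : Finset (Fin n)) (v : SympVec n) : proj M v ∈ supportedOn M := by
  intro i hi; simp [hi]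

/-- `ρ_M` fixes `P(M)`. [cite: BravyiTerhal2009, §2] -/
theorem proj_eq_self_of_mem {M : Finset (Fin n)} {v : SympVec n} (hv : v ∈ supportedOn M) :
    proj M v = v := by
  ext i <;> by_cases hi : i ∈ M
  · simp [hi]
  · simp [hi, (hv i hi).1]
  · simp [hi]
  · simp [hi, (hv i hi).2]

/-- `v = ρ_M v + ρ_{Mᶜ} v`. [cite: BravyiTerhal2009, §2] -/
theorem proj_add_proj_compl (M : Finset (Fin n)) (v : SympVec n) : proj M v + proj Mᶜ v = v := by
  ext i <;> by_cases hi : i ∈ M <;> simp [hi]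

/-- `ker ρ_M = P(Mᶜ)`. [cite: BravyiTerhal2009, §2] -/
theorem ker_proj (M : Finset (Fin n)) : LinearMap.ker (proj M) = supportedOn Mᶜ := by
  ext v
  rw [LinearMap.mem_ker, mem_supportedOn_iff]
  constructor
  · intro h i hi
    rw [mem_compl, not_not] at hi
    have h1 := congrFun (congrArg Prod.fst h) i
    have h2 := congrFun (congrArg Prod.snd h) i
    simp only [proj_apply_fst, proj_apply_snd, hi, if_true, Prod.fst_zero, Prod.snd_zero,
      Pi.zero_apply] at h1 h2
    exact ⟨h1, h2⟩
  · intro h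
    ext i <;> by_cases hi : i ∈ M
    · simp [hi, (h i (by simpa using hi)).1]
    · simp [hi]
    · simp [hi, (h i (by simpa using hi)).2]
    · simp [hi]

/-- `range ρ_M ≤ P(M)`. [cite: BravyiTerhal2009, §2] -/
theorem range_proj_le (M : Finset (Fin n)) : LinearMap.range (proj M) ≤ supportedOn M := by
  rintro _ ⟨v, rfl⟩; exact proj_mem_supportedOn M v

/-- Operators with disjoint supports commute: `P(M) ⊥ P(Mᶜ)` for the symplectic form.
[cite: BravyiTerhal2009, §2] -/
theorem sympInner_eq_zero_of_supportedOn_compl {M : Finset (Fin n)} {v w : SympVec n}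
    (hv : v ∈ supportedOn M) (hw : w ∈ supportedOn Mᶜ) : sympInner v w = 0 := by
  unfold sympInner dotProduct
  have h1 : ∀ i, v.1 i * w.2 i = 0 := fun i => by
    by_cases hi : i ∈ M
    · rw [(hw i (by simpa using hi)).2, mul_zero]
    · rw [(hv i hi).1, zero_mul]
  have h2 : ∀ i, w.1 i * v.2 i = 0 := fun i => by
    by_cases hi : i ∈ M
    · rw [(hw i (by simpa using hi)).1, zero_mul]
    · rw [(hv i hi).2, mul_zero]
  simp [h1, h2]

/-- For `u ∈ P(M)`: `⟨u, w⟩ = ⟨u, ρ_M w⟩` (the `Mᶜ`-part of `w` does not see `u`).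
[cite: BravyiTerhal2009, §2 (proof of Lemma 1)] -/
theorem sympInner_proj_right {M : Finset (Fin n)} {u : SympVec n} (hu : u ∈ supportedOn M)
    (w : SympVec n) : sympInner u (proj M w) = sympInner u w := by
  conv_rhs => rw [← proj_add_proj_compl M w]
  rw [sympInner_comm u (proj M w + proj Mᶜ w), sympInner_add_left, sympInner_comm (proj M w),
    sympInner_comm (proj Mᶜ w),
    sympInner_eq_zero_of_supportedOn_compl hu (proj_mem_supportedOn Mᶜ w), add_zero]

/-- The weight of a vector supported on `M` is at most `|M|`. [cite: BravyiTerhal2009, §2] -/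
theorem sympWeight_le_card_of_mem {M : Finset (Fin n)} {v : SympVec n} (hv : v ∈ supportedOn M) :
    sympWeight v ≤ #M := by
  unfold sympWeight
  refine card_le_card fun i hi => ?_
  by_contra hiM
  simp only [mem_filter, mem_univ, true_and] at hi
  rcases hi with h | h
  · exact h (hv i hiM).1
  · exact h (hv i hiM).2

/-! ### `dim P(M) ≤ 2|M|` -/

/-- The `2|M|` elementary vectors `(eᵢ|0)`, `(0|eᵢ)`, `i ∈ M`. [cite: CalderbankEtAl1998, §2 (Ē = 𝔽₂ⁿ × 𝔽₂ⁿ)] -/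
def elemVec (M : Finset (Fin n)) : (↥M ⊕ ↥M) → SympVec n
  | Sum.inl i => (Pi.single (i : Fin n) 1, 0)
  | Sum.inr i => (0, Pi.single (i : Fin n) 1)

/-- Every vector supported on `M` is a combination of the elementary vectors of `M`.
[cite: CalderbankEtAl1998, §2] -/
theorem supportedOn_le_span_elemVec (M : Finset (Fin n)) :
    supportedOn M ≤ Submodule.span (ZMod 2) (Set.range (elemVec M)) := by
  intro v hv
  have hdecomp : v = ∑ i : Fin n, ((Pi.single i (v.1 i), 0) + (0, Pi.single i (v.2 i)) : SympVec n) := by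
    ext j
    · simp [Prod.fst_sum, Pi.single_apply]
    · simp [Prod.snd_sum, Pi.single_apply]
  rw [hdecomp]
  refine Submodule.sum_mem _ fun i _ => ?_
  by_cases hi : i ∈ M
  · refine Submodule.add_mem _ ?_ ?_
    · have : ((Pi.single i (v.1 i), 0) : SympVec n) = v.1 i • elemVec M (Sum.inl ⟨i, hi⟩) := by
        ext j <;> simp [elemVec, Pi.single_apply]
      rw [this]
      exact Submodule.smul_mem _ _ (Submodule.subset_span ⟨_, rfl⟩)
    · have : ((0, Pi.single i (v.2 i)) : SympVec n) = v.2 i • elemVec M (Sum.inr ⟨i, hi⟩) := by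
        ext j <;> simp [elemVec, Pi.single_apply]
      rw [this]
      exact Submodule.smul_mem _ _ (Submodule.subset_span ⟨_, rfl⟩)
  · have h0 : ((Pi.single i (v.1 i), 0) + (0, Pi.single i (v.2 i)) : SympVec n) = 0 := by
      rw [(hv i hi).1, (hv i hi).2]; simp
    rw [h0]
    exact Submodule.zero_mem _

/-- **`dim P(M) ≤ 2|M|`** (in fact `=`; only `≤` is needed below). [cite: CalderbankEtAl1998, §2] -/
theorem finrank_supportedOn_le (M : Finset (Fin n)) :
    finrank (ZMod 2) (supportedOn M) ≤ 2 * #M := by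
  calc finrank (ZMod 2) (supportedOn M)
      ≤ finrank (ZMod 2) (Submodule.span (ZMod 2) (Set.range (elemVec M))) :=
        Submodule.finrank_mono (supportedOn_le_span_elemVec M)
    _ ≤ Fintype.card (↥M ⊕ ↥M) := finrank_range_le_card (R := ZMod 2) (elemVec M)
    _ = 2 * #M := by simp [two_mul]

/-! ### Rank–nullity through a subspace -/

/-- `dim T = dim f(T) + dim (T ∩ ker f)`. [folklore] -/
private theorem finrank_eq_finrank_map_add (f : SympVec n →ₗ[ZMod 2] SympVec n)
    (T : Submodule (ZMod 2) (SympVec n)) :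
    finrank (ZMod 2) T = finrank (ZMod 2) (T.map f) + finrank (ZMod 2) (T ⊓ LinearMap.ker f : Submodule (ZMod 2) (SympVec n)) := by
  have h := LinearMap.finrank_range_add_finrank_ker (f.domRestrict T)
  rw [LinearMap.range_domRestrict, LinearMap.ker_domRestrict] at h
  rw [← h, ← Submodule.finrank_map_subtype_eq T (Submodule.comap T.subtype (LinearMap.ker f)),
    Submodule.map_comap_subtype]

/-! ### The cleaning count -/

/-- (2) of the proof: a vector orthogonal to `ρ_M(S̄)` splits as its `Mᶜ`-part plus an `M`-part
orthogonal to `S̄`: `ρ_M(S̄)⊥ ≤ P(Mᶜ) + S̄⊥(M)`. [cite: BravyiTerhal2009, §2 Lemma 1 (Cleaning Lemma), proof] -/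
theorem sympDual_map_proj_le (S : Submodule (ZMod 2) (SympVec n)) (M : Finset (Fin n)) :
    sympDual (S.map (proj M)) ≤ supportedOn Mᶜ ⊔ (sympDual S ⊓ supportedOn M) := by
  intro v hv
  rw [← proj_add_proj_compl M v, add_comm]
  refine Submodule.add_mem_sup (proj_mem_supportedOn Mᶜ v)
    (Submodule.mem_inf.2 ⟨?_, proj_mem_supportedOn M v⟩)
  rw [mem_sympDual_iff]
  intro s hs
  -- ⟨s, ρ_M v⟩ = ⟨ρ_M v, s⟩ = ⟨ρ_M v, ρ_M s⟩ = ⟨v, ρ_M s⟩ - ⟨ρ_Mᶜ v, ρ_M s⟩ = 0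
  rw [sympInner_comm, ← sympInner_proj_right (proj_mem_supportedOn M v) s]
  have h1 : sympInner (proj M s) v = 0 := (mem_sympDual_iff.1 hv) _ ⟨s, hs, rfl⟩
  have h2 : sympInner (proj M s) (proj Mᶜ v) = 0 :=
    sympInner_eq_zero_of_supportedOn_compl (proj_mem_supportedOn M s) (proj_mem_supportedOn Mᶜ v)
  rw [sympInner_comm]
  rw [← proj_add_proj_compl M v, sympInner_comm, sympInner_add_left, sympInner_comm (proj Mᶜ v),
    h2, add_zero, sympInner_comm] at h1
  exact h1

/-- **Cleaning count.** For every subspace `S̄ ≤ 𝔽₂^{2n}` and coordinate set `M`: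
`dim S̄⊥(M) + dim S̄ ≥ 2|M| + dim S̄(Mᶜ)`, where `T(M) = T ∩ P(M)` (for a stabilizer code: the number
of independent logical operators supported on `M` plus those on `Mᶜ` is at least `2k`).
[cite: BravyiTerhal2009, §2 Lemma 1 (Cleaning Lemma)] -/
theorem finrank_sympDual_inf_supportedOn_ge (S : Submodule (ZMod 2) (SympVec n)) (M : Finset (Fin n)) :
    2 * #M + finrank (ZMod 2) (S ⊓ supportedOn Mᶜ : Submodule (ZMod 2) (SympVec n)) ≤
      finrank (ZMod 2) (sympDual S ⊓ supportedOn M : Submodule (ZMod 2) (SympVec n)) +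
        finrank (ZMod 2) S := by
  have hA := finrank_eq_finrank_map_add (proj M) S
  rw [ker_proj] at hA
  have hD := finrank_sympDual_add (S.map (proj M))
  have hC : finrank (ZMod 2) (sympDual (S.map (proj M))) ≤
      finrank (ZMod 2) (supportedOn Mᶜ) +
        finrank (ZMod 2) (sympDual S ⊓ supportedOn M : Submodule (ZMod 2) (SympVec n)) := by
    calc finrank (ZMod 2) (sympDual (S.map (proj M)))
        ≤ finrank (ZMod 2) (supportedOn Mᶜ ⊔ (sympDual S ⊓ supportedOn M) : Submodule (ZMod 2) (SympVec n)) :=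
          Submodule.finrank_mono (sympDual_map_proj_le S M)
      _ ≤ _ := by
          have := Submodule.finrank_sup_add_finrank_inf_eq (supportedOn Mᶜ)
            (sympDual S ⊓ supportedOn M : Submodule (ZMod 2) (SympVec n))
          omega
  have hP := finrank_supportedOn_le (Mᶜ : Finset (Fin n))
  have hcard : #(Mᶜ : Finset (Fin n)) + #M = n := by
    rw [Finset.card_compl, Fintype.card_fin]
    have := card_le_univ M
    rw [Fintype.card_fin] at this
    omega
  omega

/-- (3) of the proof: `dim T(A ∪ B) ≤ dim T(A) + 2|B|` (restrict to `B`; the kernel is supported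
on `A`). [cite: BravyiTerhal2009, §2] -/
theorem finrank_inf_supportedOn_union_le (T : Submodule (ZMod 2) (SympVec n)) (A B : Finset (Fin n)) :
    finrank (ZMod 2) (T ⊓ supportedOn (A ∪ B) : Submodule (ZMod 2) (SympVec n)) ≤
      finrank (ZMod 2) (T ⊓ supportedOn A : Submodule (ZMod 2) (SympVec n)) + 2 * #B := by
  have h := finrank_eq_finrank_map_add (proj B) (T ⊓ supportedOn (A ∪ B))
  rw [ker_proj] at h
  have hle : (T ⊓ supportedOn (A ∪ B)).map (proj B) ≤ supportedOn B := by
    rintro _ ⟨v, -, rfl⟩; exact proj_mem_supportedOn B v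
  have h1 : finrank (ZMod 2) ((T ⊓ supportedOn (A ∪ B)).map (proj B)) ≤ 2 * #B :=
    (Submodule.finrank_mono hle).trans (finrank_supportedOn_le B)
  have h2 : (T ⊓ supportedOn (A ∪ B) ⊓ supportedOn Bᶜ : Submodule (ZMod 2) (SympVec n)) ≤
      T ⊓ supportedOn A := by
    rintro v ⟨⟨hvT, hvAB⟩, hvB⟩
    refine ⟨hvT, fun i hiA => ?_⟩
    by_cases hiB : i ∈ B
    · exact hvB i (by simpa using hiB)
    · exact hvAB i (by simp [hiA, hiB])
  have h3 := Submodule.finrank_mono h2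
  omega

/-- (4) of the proof: if `|M| + 1 ≤ d` then the logical operators supported on `M` are stabilizers:
`S̄⊥(M) = S̄(M)` for a self-orthogonal `S̄` with minimum distance `d` ("case (1) of the Cleaning Lemma
cannot occur for `|M| < d`"). [cite: BravyiTerhal2009, §2 Lemma 1] -/
theorem sympDual_inf_supportedOn_eq {S : Submodule (ZMod 2) (SympVec n)} {d : ℕ}
    (hself : IsSelfOrthogonal S) (hdist : HasMinDist S d) {M : Finset (Fin n)} (hM : #M + 1 ≤ d) :
    (sympDual S ⊓ supportedOn M : Submodule (ZMod 2) (SympVec n)) = S ⊓ supportedOn M := by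
  refine le_antisymm ?_ (inf_le_inf_right _ hself)
  rintro v ⟨hvdual, hvM⟩
  refine ⟨?_, hvM⟩
  by_contra hvS
  have := hdist v hvdual hvS
  have := sympWeight_le_card_of_mem hvM
  omega

/-! ### The bound -/

/-- The asymmetric half: with `M₁`, `M₂` disjoint of size `d − 1`,
`k + 2d ≤ n + 2 + dim S̄(M₂) − dim S̄(M₁)`. [cite: Rains1999Nonbinary, Thm 2 (additive case)] -/
private theorem singleton_half {S : Submodule (ZMod 2) (SympVec n)} {k d : ℕ} (h : IsAdditiveCode S k d)
    {M₁ M₂ : Finset (Fin n)} (hdisj : Disjoint M₁ M₂) (h1 : #M₁ + 1 = d) (h2 : #M₂ + 1 = d) :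
    k + 2 * d + finrank (ZMod 2) (S ⊓ supportedOn M₁ : Submodule (ZMod 2) (SympVec n)) ≤
      n + 2 + finrank (ZMod 2) (S ⊓ supportedOn M₂ : Submodule (ZMod 2) (SympVec n)) := by
  obtain ⟨hself, hdim, hdist, -⟩ := h
  -- (2) for M₁ᶜ:  2|M₁ᶜ| + dim S(M₁) ≤ dim S⊥(M₁ᶜ) + dim S
  have hE := finrank_sympDual_inf_supportedOn_ge S M₁ᶜ
  rw [compl_compl] at hE
  -- M₁ᶜ = M₂ ∪ M₃
  set M₃ : Finset (Fin n) := M₁ᶜ \ M₂ with hM₃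
  have hunion : M₁ᶜ = M₂ ∪ M₃ := by
    ext i
    simp only [hM₃, mem_compl, mem_union, mem_sdiff]
    constructor
    · intro hi; by_cases hi2 : i ∈ M₂ <;> simp [hi, hi2]
    · rintro (hi | ⟨hi, -⟩)
      · exact fun hi1 => (Finset.disjoint_left.1 hdisj) hi1 hi
      · exact hi
  -- (3): dim S⊥(M₂ ∪ M₃) ≤ dim S⊥(M₂) + 2|M₃|, and (4): S⊥(M₂) = S(M₂)
  have h3 := finrank_inf_supportedOn_union_le (sympDual S) M₂ M₃
  rw [← hunion, sympDual_inf_supportedOn_eq hself hdist (M := M₂) (by omega)] at h3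
  -- cardinalities
  have hc1 : #(M₁ᶜ : Finset (Fin n)) + #M₁ = n := by
    rw [Finset.card_compl, Fintype.card_fin]
    have := card_le_univ M₁; rw [Fintype.card_fin] at this; omega
  have hc3 : #(M₁ᶜ : Finset (Fin n)) = #M₂ + #M₃ := by
    rw [hunion, Finset.card_union_of_disjoint Finset.disjoint_sdiff]
  -- (2) for M₁ (the other direction is not needed): S(M₁) ≤ S⊥(M₁) = S(M₁); we only use hE, h3
  omega

/-- **Quantum Singleton bound for binary stabilizer (additive) codes.** If `S̄` is an `[[n,k,d]]`
additive code with `k ≥ 1`, then `k + 2(d − 1) ≤ n`, i.e. `k ≤ n − 2d + 2`. Printed (Rains, Thm 2):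
"Let `C` be a `((n,K,d))_α` with `K > 1`. Then `K ≤ α^{n−2d+2}`"; here `α = 2`, `K = 2^k`, additive
`C`. TODO(general form): non-additive codes and `α > 2`. The hypothesis `1 ≤ k` is essential (for
`k = 0` the tree's `[[n,0,d]]` convention measures the pure weight of `S̄`, cf. `[[6,0,4]]`).
[cite: Rains1999Nonbinary, Thm 2 (Quantum Singleton bound), additive binary case] -/
theorem quantumSingleton_additive {S : Submodule (ZMod 2) (SympVec n)} {k d : ℕ}
    (h : IsAdditiveCode S k d) (hk : 1 ≤ k) : k + 2 * d ≤ n + 2 := by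
  obtain ⟨hself, hdim, hdist, -⟩ := h
  have hkn : k ≤ n := by omega
  -- trivial when d ≤ 1
  rcases Nat.lt_or_ge d 2 with hd | hd
  · omega
  -- Case A: 2(d-1) ≤ n — two disjoint sets of size d-1 exist
  by_cases hfit : 2 * (d - 1) ≤ n
  · -- M₁ = {0,…,d-2}, M₂ = {d-1,…,2d-3} as subsets of Fin n
    let M₁ : Finset (Fin n) := univ.filter fun i => (i : ℕ) < d - 1
    let M₂ : Finset (Fin n) := univ.filter fun i => d - 1 ≤ (i : ℕ) ∧ (i : ℕ) < 2 * (d - 1)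
    have hM₁ : #M₁ = d - 1 := by
      have : M₁ = (Finset.range (d - 1)).attachFin (fun i hi => by simp at hi; omega) := by
        ext i; simp [M₁, Finset.mem_attachFin]
      rw [this, Finset.card_attachFin, Finset.card_range]
    have hM₂ : #M₂ = d - 1 := by
      have : M₂ = (Finset.Ico (d - 1) (2 * (d - 1))).attachFin (fun i hi => by simp at hi; omega) := by
        ext i; simp [M₂, Finset.mem_attachFin]
      rw [this, Finset.card_attachFin, Nat.card_Ico]; omega
    have hdisj : Disjoint M₁ M₂ := by
      rw [Finset.disjoint_left]
      intro i h1 h2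
      simp only [M₁, M₂, mem_filter, mem_univ, true_and] at h1 h2
      omega
    have hA := singleton_half ⟨hself, hdim, hdist, fun hk0 => by omega⟩ hdisj (by omega) (by omega)
    have hB := singleton_half ⟨hself, hdim, hdist, fun hk0 => by omega⟩ hdisj.symm (by omega) (by omega)
    omega
  · -- Case B: n < 2(d-1): take M of size min(n, d-1); then both M and Mᶜ are small, forcing k = 0
    exfalso
    let M : Finset (Fin n) := univ.filter fun i => (i : ℕ) < d - 1
    have hMle : #M ≤ d - 1 := by
      have : M = ((Finset.range (d - 1)).filter (· < n)).attachFin (fun i hi => by simp at hi; omega) := by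
        ext i; simp [M, Finset.mem_attachFin, i.isLt]
      rw [this, Finset.card_attachFin]
      exact (card_filter_le _ _).trans (by simp)
    have hMc : #(Mᶜ : Finset (Fin n)) ≤ d - 1 := by
      -- Mᶜ = {i | d-1 ≤ i < n} has n - (d-1) < d-1 elements (or is empty if n ≤ d-1)
      have hsub : (Mᶜ : Finset (Fin n)) ⊆ (Finset.Ico (d - 1) n).attachFin (fun i hi => by simp at hi; omega) := by
        intro i hi
        simp only [M, mem_compl, mem_filter, mem_univ, true_and, not_lt] at hi
        simp [Finset.mem_attachFin, hi, i.isLt]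
      refine (card_le_card hsub).trans ?_
      rw [Finset.card_attachFin, Nat.card_Ico]
      omega
    have hE1 := finrank_sympDual_inf_supportedOn_ge S M
    have hE2 := finrank_sympDual_inf_supportedOn_ge S Mᶜ
    rw [compl_compl] at hE2
    rw [sympDual_inf_supportedOn_eq hself hdist (M := M) (by omega)] at hE1
    rw [sympDual_inf_supportedOn_eq hself hdist (M := Mᶜ) (by omega)] at hE2
    have hc : #(Mᶜ : Finset (Fin n)) + #M = n := by
      rw [Finset.card_compl, Fintype.card_fin]
      have := card_le_univ M; rw [Fintype.card_fin] at this; omega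
    omega

/-- **Quantum Singleton bound, existence form:** an `[[n,k,d]]` additive code with `k ≥ 1` has
`k + 2d ≤ n + 2`. [cite: Rains1999Nonbinary, Thm 2 (Quantum Singleton bound), additive binary case] -/
theorem AdditiveCodeExists.quantumSingleton {n k d : ℕ} (h : AdditiveCodeExists n k d) (hk : 1 ≤ k) :
    k + 2 * d ≤ n + 2 := by
  obtain ⟨S, hS⟩ := h
  exact quantumSingleton_additive hS hk


/-! ### The Cleaning Lemma (Bravyi–Terhal 2009, Lemma 1) in symplectic form -/

/-- If no non-trivial logical operator is supported inside `M` (`S̄⊥ ∩ P(M) ≤ S̄`), then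
`S̄ + S̄⊥(Mᶜ) = S̄⊥`: every element of the normaliser is a stabilizer times an operator acting trivially
on `M`. (Dimension count: two applications of `finrank_sympDual_inf_supportedOn_ge` and `dim S̄⊥ + dim S̄
= 2n`.) [cite: BravyiTerhal2009, §2 Lemma 1 (Cleaning Lemma), case (2)] -/
theorem sup_sympDual_inf_supportedOn_compl_eq {S : Submodule (ZMod 2) (SympVec n)}
    (hself : IsSelfOrthogonal S) {M : Finset (Fin n)}
    (hM : (sympDual S ⊓ supportedOn M : Submodule (ZMod 2) (SympVec n)) ≤ S) :
    S ⊔ (sympDual S ⊓ supportedOn Mᶜ) = sympDual S := by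
  have hle : S ⊔ (sympDual S ⊓ supportedOn Mᶜ) ≤ sympDual S := sup_le hself inf_le_left
  refine Submodule.eq_of_le_of_finrank_le hle ?_
  -- dimension count
  have hMeq : (sympDual S ⊓ supportedOn M : Submodule (ZMod 2) (SympVec n)) = S ⊓ supportedOn M :=
    le_antisymm (le_inf hM inf_le_right) (inf_le_inf_right _ hself)
  have h1 := finrank_sympDual_inf_supportedOn_ge S M
  have h2 := finrank_sympDual_inf_supportedOn_ge S Mᶜ
  rw [hMeq] at h1
  rw [compl_compl] at h2
  have hD := finrank_sympDual_add S
  have hsup := Submodule.finrank_sup_add_finrank_inf_eq S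
    (sympDual S ⊓ supportedOn Mᶜ : Submodule (ZMod 2) (SympVec n))
  have hinf : (S ⊓ (sympDual S ⊓ supportedOn Mᶜ) : Submodule (ZMod 2) (SympVec n)) = S ⊓ supportedOn Mᶜ := by
    rw [← inf_assoc, inf_eq_left.2 hself]
  rw [hinf] at hsup
  have hc : #(Mᶜ : Finset (Fin n)) + #M = n := by
    rw [Finset.card_compl, Fintype.card_fin]
    have := card_le_univ M; rw [Fintype.card_fin] at this; omega
  omega

/-- **Cleaning Lemma (Bravyi–Terhal 2009, Lemma 1), symplectic form.** Let `S̄` be a self-orthogonal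
(stabilizer) space spanned by a family of generators `g`, and `M` any set of qubits. Then EITHER (1) some
non-trivial logical operator (element of `S̄⊥ ∖ S̄`) is supported inside `M`, OR (2) every `P ∈ S̄⊥` can be
multiplied by a product `s` of generators WHOSE SUPPORT MEETS `M` so that `P + s` acts trivially on `M`
(is supported on `Mᶜ`). «Lemma 1 (Cleaning Lemma). Let `S = ⟨S_1,…,S_m⟩` be a stabilizer code and `M ⊆ Λ`
be an arbitrary subset of qubits. Denote `J(M)` a set of indexes `a` such that the support of `S_a` overlaps
with `M`. Then one of the following is true: (1) There exists a non-trivial logical operator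
`P ∈ C(S)∖S` whose support is contained in `M`, (2) For any logical operator `P ∈ C(S)` one can choose a
stabilizer `S = ∏_{a ∈ J(M)} S_a^{x_a}` such that `PS` acts trivially on qubits of `M`.»
[cite: BravyiTerhal2009, §2 Lemma 1 (Cleaning Lemma)] -/
theorem BravyiTerhal2009_cleaningLemma {ι : Type*} (g : ι → SympVec n)
    {S : Submodule (ZMod 2) (SympVec n)} (hS : S = Submodule.span (ZMod 2) (Set.range g))
    (hself : IsSelfOrthogonal S) (M : Finset (Fin n)) :
    (∃ P ∈ sympDual S, P ∉ S ∧ P ∈ supportedOn M) ∨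
      (∀ P ∈ sympDual S,
        ∃ s ∈ Submodule.span (ZMod 2) (g '' {a | g a ∉ supportedOn Mᶜ}), P + s ∈ supportedOn Mᶜ) := by
  by_cases h1 : ∃ P ∈ sympDual S, P ∉ S ∧ P ∈ supportedOn M
  · exact Or.inl h1
  refine Or.inr fun P hP => ?_
  push Not at h1
  have hM : (sympDual S ⊓ supportedOn M : Submodule (ZMod 2) (SympVec n)) ≤ S := by
    intro v hv
    by_contra hvS
    exact h1 v hv.1 hvS hv.2
  -- clean with an arbitrary stabilizer first
  have hP' : P ∈ S ⊔ (sympDual S ⊓ supportedOn Mᶜ) := by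
    rw [sup_sympDual_inf_supportedOn_compl_eq hself hM]; exact hP
  obtain ⟨s, hs, q, hq, hsq⟩ := Submodule.mem_sup.1 hP'
  -- split s along generators meeting / avoiding M
  have hsplit : S ≤ Submodule.span (ZMod 2) (g '' {a | g a ∉ supportedOn Mᶜ}) ⊔
      Submodule.span (ZMod 2) (g '' {a | g a ∈ supportedOn Mᶜ}) := by
    rw [hS, ← Submodule.span_union, ← Set.image_union]
    apply Submodule.span_mono
    rintro _ ⟨a, rfl⟩
    by_cases ha : g a ∈ supportedOn Mᶜ
    · exact ⟨a, Or.inr ha, rfl⟩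
    · exact ⟨a, Or.inl ha, rfl⟩
  obtain ⟨s₁, hs₁, s₂, hs₂, rfl⟩ := Submodule.mem_sup.1 (hsplit hs)
  have hs₂' : s₂ ∈ supportedOn Mᶜ :=
    (Submodule.span_le.2 (by rintro _ ⟨a, ha, rfl⟩; exact ha)) hs₂
  refine ⟨s₁, hs₁, ?_⟩
  -- P + s₁ = q + s₂ over 𝔽₂ (P = s₁ + s₂ + q)
  have hchar : P + s₁ = q + s₂ := by
    rw [← hsq]
    have h2 : s₁ + s₁ = 0 := by
      rw [← two_smul (ZMod 2) s₁]
      exact (show (2 : ZMod 2) = 0 from rfl) ▸ zero_smul _ _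
    calc s₁ + s₂ + q + s₁ = (s₁ + s₁) + (q + s₂) := by abel
      _ = q + s₂ := by rw [h2, zero_add]
  rw [hchar]
  exact Submodule.add_mem _ hq.2 hs₂'

end Literature.InformationTheory.QuantumCodes
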